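import Summits.MatrixMultiplication.OmegaCensus.STPPVosperSlackTwoRows59L2B1
import Summits.MatrixMultiplication.OmegaCensus.STPPVosperSlackTwoRows59L2B2

/-!
# ω-census (abelian STPP census): ℤ₅₉ leaf L2 = {(2,2,3),(3,4,2)²} — slack-2 three-block law, case B′ rows up to dihedral symmetry — rows assembled (kernel rows → law form)

HONEST FRAMING (pub-omega census; verbatim): lottery ticket; floor = certified bounds/negative ranges.
Census STRUCTURE (seat pub-omega-stpp-2 gen 27, 2026-08-29), family (b2).  The 10 chunk theorems `rows59L2B_c0 … rows59L2B_c9` glued into the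
hypothesis form the law consumes (`rows59L2B`).  No new computation.  Nothing here is progress on `ω`.
-/

namespace Summit.MatrixMultiplication.OmegaCensus.CubeNB.S2

/-- **Assembled rows** (`ℤ₅₉ leaf L2 = {(2,2,3),(3,4,2)²} — slack-2 three-block law, case B′ rows up to dihedral symmetry`). [folklore] -/
theorem rows59L2B : ∀ Q ∈ qShapes 59 2 0 58, dihedralSmaller 59 Q = true ∨ caseADeadT 59 3 4 14 16 Q tblZ59L2B = true := by
  have g0 : ∀ Q ∈ qShapes 59 2 0 37, dihedralSmaller 59 Q = true ∨ caseADeadT 59 3 4 14 16 Q tblZ59L2B = true := (rowsQ_of_all rows59L2B_c0)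
  have g1 : ∀ Q ∈ qShapes 59 2 0 40, dihedralSmaller 59 Q = true ∨ caseADeadT 59 3 4 14 16 Q tblZ59L2B = true :=
    forall_qShapes_append (by decide) (by decide) g0 (rowsQ_of_all rows59L2B_c1)
  have g2 : ∀ Q ∈ qShapes 59 2 0 45, dihedralSmaller 59 Q = true ∨ caseADeadT 59 3 4 14 16 Q tblZ59L2B = true :=
    forall_qShapes_append (by decide) (by decide) g1 (rowsQ_of_all rows59L2B_c2)
  have g3 : ∀ Q ∈ qShapes 59 2 0 48, dihedralSmaller 59 Q = true ∨ caseADeadT 59 3 4 14 16 Q tblZ59L2B = true :=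
    forall_qShapes_append (by decide) (by decide) g2 (rowsQ_of_all rows59L2B_c3)
  have g4 : ∀ Q ∈ qShapes 59 2 0 50, dihedralSmaller 59 Q = true ∨ caseADeadT 59 3 4 14 16 Q tblZ59L2B = true :=
    forall_qShapes_append (by decide) (by decide) g3 (rowsQ_of_all rows59L2B_c4)
  have g5 : ∀ Q ∈ qShapes 59 2 0 52, dihedralSmaller 59 Q = true ∨ caseADeadT 59 3 4 14 16 Q tblZ59L2B = true :=
    forall_qShapes_append (by decide) (by decide) g4 (rowsQ_of_all rows59L2B_c5)
  have g6 : ∀ Q ∈ qShapes 59 2 0 54, dihedralSmaller 59 Q = true ∨ caseADeadT 59 3 4 14 16 Q tblZ59L2B = true :=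
    forall_qShapes_append (by decide) (by decide) g5 (rowsQ_of_all rows59L2B_c6)
  have g7 : ∀ Q ∈ qShapes 59 2 0 55, dihedralSmaller 59 Q = true ∨ caseADeadT 59 3 4 14 16 Q tblZ59L2B = true :=
    forall_qShapes_append (by decide) (by decide) g6 (rowsQ_of_all rows59L2B_c7)
  have g8 : ∀ Q ∈ qShapes 59 2 0 56, dihedralSmaller 59 Q = true ∨ caseADeadT 59 3 4 14 16 Q tblZ59L2B = true :=
    forall_qShapes_append (by decide) (by decide) g7 (rowsQ_of_all rows59L2B_c8)
  have g9 : ∀ Q ∈ qShapes 59 2 0 58, dihedralSmaller 59 Q = true ∨ caseADeadT 59 3 4 14 16 Q tblZ59L2B = true :=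
    forall_qShapes_append (by decide) (by decide) g8 (rowsQ_of_all rows59L2B_c9)
  exact g9

/-- The same with the bound written `(59 − 1).choose (2 − 1)`. [folklore] -/
theorem rows59L2B_choose : ∀ Q ∈ qShapes 59 2 0 ((59 - 1).choose (2 - 1)), dihedralSmaller 59 Q = true ∨ caseADeadT 59 3 4 14 16 Q tblZ59L2B = true := by
  have e : (59 - 1).choose (2 - 1) = 58 := by decide
  rw [e]
  exact rows59L2B

end Summit.MatrixMultiplication.OmegaCensus.CubeNB.S2
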